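import Summits.HodgeConjecture.CorCM.Model.GysinRational
import Summits.HodgeConjecture.CorCM.Model.CupAlgebraic
import Summits.HodgeConjecture.CorCM.Model.KunnethTopClass
import Summits.HodgeConjecture.CorCM.Model.TopTraceUnit
import HarnessLib

/-!
# COR-CM model layer, part 7 (row M22 `Fact_algDuality`, kernel K-c): the action of an algebraic
# correspondence on rational algebraic classes, and the Fourier-type sums `Σ_c tr(z ∪ x_c) • y_c`

Cell `pub-hodgecm2` (COR-CM), seat `b17`; kernel **K-c** of row M22 of `BINDER-OWNERS.md` (v3, F-1 option (ii):
`Fact_algDuality` is PROVED in the tree).  The stage-1 fact `Fact_algDuality` (`HodgeCM/Geometry/Facts.lean`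
l.251; port `CorCM/Geometry/Facts.lean`) asks, for the corner product `P`, `d = dim P`, for a `ℚ`-linear bijection
`D : H^{2(d-2)}(P; ℚ) → H⁴(P; ℚ)` with (i) `(alg P (d-2)).map D ≤ alg P 2` and (ii) an intertwining property.
Kernel K-a (seat model-1) builds `D` by linear algebra on `⋀• H¹(P)` and shows it is a Fourier-type operator
`D z = Σ_c tr_P(z ∪ x_c) • y_c`; kernel K-b (seat b16) shows that `u = Σ_c pr₁^* x_c ∪ pr₂^* y_c` is (`±` a power of
the Poincaré class, hence) a rational algebraic class on `P × P`.  THIS FILE supplies clause (i) from those two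
inputs, on the tree objects the model universe is made of (`Motives.bettiCohomology`, `BettiUniverse.pull/cup/tr`,
`PicardCM.ratAlgebraicClasses`, the RATIONAL Gysin maps `gysinMap (complexOrientationRat _) (complexOrientationRat _)`
of `CorCM/GysinSurface`, `CorCM/Model/GysinRational`):

* `gysinMap_mem_ratAlgebraicClasses_of_supportedClasses` — a rational Gysin map `g_!` sends a rational class whose
  complexification lies in `Nᵉ Hᵃ` to a rational algebraic class of codimension `s`, `s + dim T ≤ dim Y + e`
  (the tree's `complexGysin_mem_supportedClasses` + `complexGysin_ringChange_eq_smul_gysinMap`; the general-degree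
  form of model-1's `gysinMap_mem_ratAlgebraicClasses`);
* `gysin_cup_pull_mem_ratAlgebraicClasses` (**K-c (i)**) — for smooth projective `T, X, Y`, morphisms `f : T ⟶ X`,
  `g : T ⟶ Y`, a rational algebraic class `u` on `T` and `z ∈ alg X p`, the class `g_!(f^* z ∪ u)` is rational
  algebraic on `Y` (Fulton, *Intersection Theory* §16.1: correspondences act on algebraic cycles; here:
  pull-back `fulton1998_map_mem_algebraicClasses_holds`, cup product `Voisin2003_cupProduct_algebraicClasses_holds`
  (model-1's `cup_mem_supportedClasses`), Gysin as above) — with `T = X ⊗ Y`, `f = fst`, `g = snd` this is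
  «`z ↦ pr₂!(pr₁^* z ∪ u)` maps `alg` to `alg`», and with `f = snd`, `g = fst` the tree's `corrAction` convention;
* `gysinMap_top_injective` — `g_!` is injective in the top degree of the source (any way that degree is written);
* `exists_gysin_snd_pull_fst` — **base change to the point**: there is `r ∈ ℚ`, `r ≠ 0`, with
  `snd_!(fst^* w) = (r · tr_X w) • 1_Y` in `H⁰(Y(ℂ); ℚ)` for every top-degree `w` on `X` (`H⁰(Y; ℚ) = ℚ · 1`,
  model-2's `eq_smul_one_of_pathConnectedSpace_rat`; two functionals on the top line; `r ≠ 0` because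
  `snd_!(fst^* w₀ ∪ snd^* y₀) = snd_!(fst^* w₀) ∪ y₀` (projection formula `gysinMap_cupProduct_map`) is non-zero for
  non-zero top classes: model-1's binary Künneth top class `cup_pull_fst_pull_snd_top_ne_zero` and top injectivity);
* `gysin_snd_cup_pull_fst_cup` — `snd_!(fst^* z ∪ (fst^* x ∪ snd^* y)) = (r · tr_X(z ∪ x)) • y`
  (associativity, `fst^*` multiplicative, projection formula, base change to the point);
* `fourierSum_mem_ratAlgebraicClasses` (**consumable form of clause (i)**) — if
  `u = Σ_{c ∈ S} fst^* x_c ∪ snd^* y_c` is a rational algebraic class on `X ⊗ Y` and `z ∈ alg X p`, then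
  `Σ_{c ∈ S} tr_X(z ∪ x_c) • y_c ∈ alg Y s` (`= r⁻¹ • snd_!(fst^* z ∪ u)`), and the operator form
  `ratAlgebraicClasses_map_fourierSum_le`: `(alg X p).map (z ↦ Σ_c tr_X(z ∪ x_c) • y_c) ≤ alg Y s` — literally the
  shape of clause (i) of `Fact_algDuality` for a Fourier-type `D` (template: the tree's Weil-cohomology
  `Motives.fourierOp` / `isAlgebraicOperator_fourierOp`, `Motives/AbelianVarietyExterior.lean`);
* `var_fourierSum_mem_alg` — the same on the index type `PicardCM.Var` of the model universe (`Var.prod v w` is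
  interpreted by `scheme v ⊗ scheme w`, `Var.fst/snd` by the cartesian projections).

The light trace `BettiUniverse.tr` is a coordinate functional on the top line, not `∫`; every statement is
insensitive to that normalisation (absorbed in `r`).  Degrees are kept in the additive shapes produced by
`BettiUniverse.cup` (`2p + 2q`, …) with the identifications `2p + 2q = 2n` as explicit hypotheses, so that
instantiation at numerals (`H⁴ = H^{2·2}`) is by `rfl`.  No definitions; no named facts; explicit binders.

Print shape: Fulton, *Intersection Theory* (1998) §16.1 (correspondences), Prop. 1.7 (push-pull for the
product square); Kleiman, *Algebraic cycles and the Weil conjectures* (1968) §1.3; Voisin, *Hodge Theory II*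
Prop. 9.20–9.21.  Here entirely a theorem of the tree.
-/

noncomputable section

open CategoryTheory MonoidalCategory CartesianMonoidalCategory
open Literature.AlgebraicTopology.SingularHomology
open Literature.AlgebraicGeometry.Motives (SchemeOver ComplexPoints IsSmoothProjective bettiCohomology bettiOne
  IsSmoothProjective.tensor_holds)
open Literature.AlgebraicGeometry.HodgeTheory
open Literature.NumberTheory.Automorphic.PicardCM

namespace Summit.HodgeConjecture.CorCM.Model

section General

variable {t n m : ℕ} {T X Y : SchemeOver ℂ}

/-! ### Rational Gysin maps and the coniveau -/

/-- **Rational Gysin maps lower the coniveau by at most the relative dimension** (general degrees): for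
`g : T ⟶ Y` smooth projective of dimensions `t`, `m`, a rational class `y ∈ Hᵃ(T(ℂ); ℚ)` whose complexification
lies in `Nᵉ Hᵃ(T(ℂ); ℂ)`, and `s + t ≤ m + e`, the class `g_! y ∈ H^{2s}(Y(ℂ); ℚ)` is rational algebraic of
codimension `s` (complex Gysin maps preserve supports, `complexGysin_mem_supportedClasses`; the rational Gysin map is
a non-zero multiple of the complex one on rational classes, `complexGysin_ringChange_eq_smul_gysinMap`). -/
theorem gysinMap_mem_ratAlgebraicClasses_of_supportedClasses (hT : IsSmoothProjective t T)
    (hY : IsSmoothProjective m Y) (g : T ⟶ Y) {a q e s : ℕ} (ha : a + q = 2 * t) (hb : 2 * s + q = 2 * m)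
    (hes : s + t ≤ m + e) {y : bettiCohomology T a}
    (hy : ofRatClass (ComplexPoints T) a y ∈ supportedClasses T a e) :
    gysinMap (complexOrientationRat hT) (complexOrientationRat hY)
        (Literature.AlgebraicGeometry.Motives.AlgPoints.mapContinuous (L := ℂ) g) ha hb y ∈
      ratAlgebraicClasses Y s := by
  rw [mem_ratAlgebraicClasses_iff, ofRatClass_eq_ringChange]
  rw [ofRatClass_eq_ringChange] at hy
  obtain ⟨u, hu, hug⟩ := complexGysin_ringChange_eq_smul_gysinMap (μ := complexOrientationFamily)
    hasPoincareDuality_complexOrientationFamily hT hY g (a := a) (b := 2 * s) (q := q) ha hb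
    (complexOrientationRat hT) (complexOrientationRat hY) (hasPoincareDuality_complexOrientationRat hY)
  have h1 : singularCohomology.ringChange (algebraMap ℚ ℂ) (ComplexPoints Y) (2 * s)
        (gysinMap (complexOrientationRat hT) (complexOrientationRat hY)
          (Literature.AlgebraicGeometry.Motives.AlgPoints.mapContinuous (L := ℂ) g) ha hb y) =
      u⁻¹ • complexGysin complexOrientationFamily hT hY g
        (show a + 2 * m = 2 * s + 2 * t by omega)
        (singularCohomology.ringChange (algebraMap ℚ ℂ) (ComplexPoints T) a y) := by
    rw [hug, smul_smul, inv_mul_cancel₀ hu, one_smul]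
  rw [h1]
  exact Submodule.smul_mem _ _
    (complexGysin_mem_supportedClasses (gysinMap_restrictCompl_eq_zero_of_field ℂ) complexOrientationFamily
      hasPoincareDuality_complexOrientationFamily hT hY g _ (r := e) (s := s) hes hy)

/-- **K-c (i): the action of an algebraic correspondence preserves rational algebraic classes.**  For smooth
projective `T, X, Y` (dimensions `t, n, m`), morphisms `f : T ⟶ X`, `g : T ⟶ Y`, a rational class
`u ∈ Hᵃ(T(ℂ); ℚ)` with complexification in `Nᵉ Hᵃ` where `a = 2e` (e.g. `u ∈ alg T e`), and `z ∈ alg X p`, the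
class `g_!(f^* z ∪ u) ∈ H^{2s}(Y(ℂ); ℚ)` (`2p + a + q = 2t`, `2s + q = 2m`, so `s = p + e - (t - m)`) is rational
algebraic of codimension `s`: pull-back (Fulton Cor. 19.2 (b)), cup product (Voisin II Prop. 9.20) and Gysin map
each preserve algebraicity.  With `T = X ⊗ Y`, `f = fst`, `g = snd` this is the map `z ↦ pr₂!(pr₁^* z ∪ u)`. -/
theorem gysin_cup_pull_mem_ratAlgebraicClasses' (hT : IsSmoothProjective t T) (hX : IsSmoothProjective n X)
    (hY : IsSmoothProjective m Y) (f : T ⟶ X) (g : T ⟶ Y) {p a e s q : ℕ} (hae : a = 2 * e)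
    (ha : 2 * p + a + q = 2 * t) (hb : 2 * s + q = 2 * m) {u : bettiCohomology T a}
    (hu : ofRatClass (ComplexPoints T) a u ∈ supportedClasses T a e) {z : bettiCohomology X (2 * p)}
    (hz : z ∈ ratAlgebraicClasses X p) :
    gysinMap (complexOrientationRat hT) (complexOrientationRat hY)
        (Literature.AlgebraicGeometry.Motives.AlgPoints.mapContinuous (L := ℂ) g) ha hb
        (BettiUniverse.cup T (2 * p) a (BettiUniverse.pull f (2 * p) z) u) ∈
      ratAlgebraicClasses Y s := by
  subst hae
  have hx : BettiUniverse.pull f (2 * p) z ∈ ratAlgebraicClasses T p :=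
    ratAlgebraicClasses_map_pull_le hX hT f p ⟨z, hz, rfl⟩
  have hu' : u ∈ ratAlgebraicClasses T e := (mem_ratAlgebraicClasses_iff T e u).2 hu
  exact gysinMap_mem_ratAlgebraicClasses_of_supportedClasses hT hY g ha hb (by omega)
    (cup_mem_supportedClasses hT hx hu')

/-- **K-c (i)**, with `u ∈ alg T e` a rational algebraic class in its own degree `2e`:
`g_!(f^* z ∪ u) ∈ alg Y s` for `z ∈ alg X p` (`2p + 2e + q = 2t`, `2s + q = 2m`). -/
theorem gysin_cup_pull_mem_ratAlgebraicClasses (hT : IsSmoothProjective t T) (hX : IsSmoothProjective n X)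
    (hY : IsSmoothProjective m Y) (f : T ⟶ X) (g : T ⟶ Y) {p e s q : ℕ}
    (ha : 2 * p + 2 * e + q = 2 * t) (hb : 2 * s + q = 2 * m) {u : bettiCohomology T (2 * e)}
    (hu : u ∈ ratAlgebraicClasses T e) {z : bettiCohomology X (2 * p)} (hz : z ∈ ratAlgebraicClasses X p) :
    gysinMap (complexOrientationRat hT) (complexOrientationRat hY)
        (Literature.AlgebraicGeometry.Motives.AlgPoints.mapContinuous (L := ℂ) g) ha hb
        (BettiUniverse.cup T (2 * p) (2 * e) (BettiUniverse.pull f (2 * p) z) u) ∈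
      ratAlgebraicClasses Y s :=
  gysin_cup_pull_mem_ratAlgebraicClasses' hT hX hY f g rfl ha hb ((mem_ratAlgebraicClasses_iff T e u).1 hu) hz

/-! ### Top-degree injectivity of a rational Gysin map -/

/-- **A rational Gysin map is injective in the top degree of its source** (`g_! w = 0 → w = 0`, the top degree
`a` written in any way with `a + 0 = 2 dim T`): `g_! w ⌢ [Y] = g(ℂ)_*(w ⌢ [T])`, `⌢ [T]` is injective
(Poincaré duality) and `g(ℂ)_*` is injective on `H₀` (`T(ℂ)` path connected; model-1's `map_zero_injective`). -/
theorem gysinMap_top_injective (hT : IsSmoothProjective t T) (hY : IsSmoothProjective m Y) (g : T ⟶ Y)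
    {a b : ℕ} (ha : a + 0 = 2 * t) (hb : b + 0 = 2 * m) {w : bettiCohomology T a}
    (hw : gysinMap (complexOrientationRat hT) (complexOrientationRat hY)
      (Literature.AlgebraicGeometry.Motives.AlgPoints.mapContinuous (L := ℂ) g) ha hb w = 0) : w = 0 := by
  have hcap := capProduct_gysinMap (μY := complexOrientationRat hT)
    (hasPoincareDuality_complexOrientationRat hY)
    (Literature.AlgebraicGeometry.Motives.AlgPoints.mapContinuous (L := ℂ) g) ha hb w
  rw [hw, LinearMap.map_zero₂] at hcap
  have hzero : capProduct ha w (complexOrientationRat hT).fundamentalClass = 0 :=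
    map_zero_injective hT g (X := Y) (by rw [← hcap, map_zero])
  refine (hasPoincareDuality_complexOrientationRat hT ha).1 ?_
  rw [poincareDualityMap_apply, hzero, poincareDualityMap_apply, LinearMap.map_zero₂]

/-! ### Push-pull for the square `X ⊗ Y → Y` over `X → pt`: the base change to the point -/

/-- Projection formula for `snd : X ⊗ Y ⟶ Y` and a class pulled back from `X`:
`snd_!(fst^* v ∪ snd^* y) = snd_!(fst^* v) ∪ y` (Fulton App. B (6), the tree's sign-free
`gysinMap_cupProduct_map`; degrees `i + l + q = 2(n + m)`, `b + l + q = 2m`, `i + k = 2(n+m)`, `b + k = 2m`). -/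
theorem gysin_snd_cup_pull_fst_pull_snd (hX : IsSmoothProjective n X) (hY : IsSmoothProjective m Y)
    {i l b q k : ℕ} (ha : i + l + q = 2 * (n + m)) (hb : b + l + q = 2 * m) (hak : i + k = 2 * (n + m))
    (hbk : b + k = 2 * m) (v : bettiCohomology X i) (y : bettiCohomology Y l) :
    gysinMap (complexOrientationRat (IsSmoothProjective.tensor_holds hX hY)) (complexOrientationRat hY)
        (Literature.AlgebraicGeometry.Motives.AlgPoints.mapContinuous (L := ℂ) (snd X Y)) ha hb
        (BettiUniverse.cup (X ⊗ Y) i l (BettiUniverse.pull (fst X Y) i v) (BettiUniverse.pull (snd X Y) l y)) =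
      BettiUniverse.cup Y b l
        (gysinMap (complexOrientationRat (IsSmoothProjective.tensor_holds hX hY)) (complexOrientationRat hY)
          (Literature.AlgebraicGeometry.Motives.AlgPoints.mapContinuous (L := ℂ) (snd X Y)) hak hbk
          (BettiUniverse.pull (fst X Y) i v)) y := by
  have hkq : k = l + q := by omega
  subst hkq
  exact gysinMap_cupProduct_map (μY := complexOrientationRat (IsSmoothProjective.tensor_holds hX hY))
    (μX := complexOrientationRat hY) (hasPoincareDuality_complexOrientationRat hY)
    (Literature.AlgebraicGeometry.Motives.AlgPoints.mapContinuous (L := ℂ) (snd X Y))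
    (a := i) (p := l) (s := i + l) (q := q) (t := b + l) (k := l + q) (b := b) rfl ha hb rfl hak hbk rfl
    (BettiUniverse.pull (fst X Y) i v) y

/-- **Base change to the point for the product square** (`X ⊗ Y → Y` over `X → Spec ℂ`; Fulton Prop. 1.7):
there is `r ∈ ℚ`, `r ≠ 0`, such that `snd_!(fst^* w) = (r · tr_X w) • 1_Y` in `H⁰(Y(ℂ); ℚ)` for every class `w`
of top degree `k = 2 dim X` on `X` (for every spelling `q`, `k + q = 2(n+m)`, `0 + q = 2m`, of the Gysin degrees).
Proof: `H⁰(Y(ℂ); ℚ) = ℚ · 1` (`Y(ℂ)` path connected), so `w ↦ snd_!(fst^* w)` is a functional on the top LINE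
`H^{2n}(X(ℂ); ℚ)` times `1`, hence `r · tr_X` times `1`; and `r ≠ 0`: for non-zero top classes `w₀`, `y₀` of `X`, `Y`
the class `fst^* w₀ ∪ snd^* y₀` is a non-zero top class of `X ⊗ Y` (model-1's `cup_pull_fst_pull_snd_top_ne_zero`),
so `0 ≠ snd_!(fst^* w₀ ∪ snd^* y₀) = snd_!(fst^* w₀) ∪ y₀` (top injectivity, projection formula). -/
theorem exists_gysin_snd_pull_fst (hX : IsSmoothProjective n X) (hY : IsSmoothProjective m Y) {k : ℕ}
    (hk : k = 2 * n) :
    ∃ r : ℚ, r ≠ 0 ∧ ∀ {q : ℕ} (ha : k + q = 2 * (n + m)) (hb : 0 + q = 2 * m) (w : bettiCohomology X k),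
      gysinMap (complexOrientationRat (IsSmoothProjective.tensor_holds hX hY)) (complexOrientationRat hY)
          (Literature.AlgebraicGeometry.Motives.AlgPoints.mapContinuous (L := ℂ) (snd X Y)) ha hb
          (BettiUniverse.pull (fst X Y) k w) =
        (r * BettiUniverse.tr hX k w) • bettiOne Y := by
  subst hk
  haveI := pathConnectedSpace_complexPoints hY
  have hXY := IsSmoothProjective.tensor_holds hX hY
  have h1X : Module.finrank ℚ (bettiCohomology X (2 * n)) = 1 := finrank_rat_top hX
  have h1Y : Module.finrank ℚ (bettiCohomology Y (2 * m)) = 1 := finrank_rat_top hY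
  -- the push-pull map in the canonical spelling of its degrees
  have ha₀ : 2 * n + 2 * m = 2 * (n + m) := by ring
  have hb₀ : 0 + 2 * m = 2 * m := Nat.zero_add _
  set G : bettiCohomology X (2 * n) →ₗ[ℚ] bettiCohomology Y 0 :=
    gysinMap (complexOrientationRat hXY) (complexOrientationRat hY)
        (Literature.AlgebraicGeometry.Motives.AlgPoints.mapContinuous (L := ℂ) (snd X Y)) ha₀ hb₀ ∘ₗ
      BettiUniverse.pull (fst X Y) (2 * n) with hG
  -- `H⁰(Y; ℚ) = ℚ · 1`: `G w = ε (G w) • 1`, and `ε ∘ G = r • tr_X` on the top line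
  set φ : bettiCohomology X (2 * n) →ₗ[ℚ] ℚ :=
    (singularCohomologyZeroEquiv ℚ ℚ (ComplexPoints Y)).toLinearMap ∘ₗ G with hφ
  obtain ⟨r, hr⟩ := exists_eq_smul_of_finrank_eq_one' h1X φ (BettiUniverse.tr hX (2 * n))
    (BettiUniverse.tr_ne_zero hX h1X)
  have key : ∀ w : bettiCohomology X (2 * n), G w = (r * BettiUniverse.tr hX (2 * n) w) • bettiOne Y := by
    intro w
    have h := eq_smul_one_of_pathConnectedSpace_rat (Y := ComplexPoints Y) (G w)
    have hφw : singularCohomologyZeroEquiv ℚ ℚ (ComplexPoints Y) (G w) = φ w := rfl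
    rw [hφw, hr, LinearMap.smul_apply, smul_eq_mul] at h
    exact h
  refine ⟨r, ?_, fun {q} ha hb w ↦ ?_⟩
  · -- `r ≠ 0`
    rintro rfl
    have hG0 : ∀ w : bettiCohomology X (2 * n), G w = 0 := fun w ↦ by
      rw [key w, zero_mul, zero_smul]
    have hw₀ : BettiUniverse.lineBasis hX (2 * n) h1X 0 ≠ 0 := (BettiUniverse.lineBasis hX (2 * n) h1X).ne_zero 0
    have hy₀ : BettiUniverse.lineBasis hY (2 * m) h1Y 0 ≠ 0 := (BettiUniverse.lineBasis hY (2 * m) h1Y).ne_zero 0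
    refine cup_pull_fst_pull_snd_top_ne_zero hX hY hw₀ hy₀
      (gysinMap_top_injective hXY hY (snd X Y) (a := 2 * n + 2 * m) (b := 0 + 2 * m) (by omega) (by omega) ?_)
    rw [gysin_snd_cup_pull_fst_pull_snd hX hY (i := 2 * n) (l := 2 * m) (b := 0) (q := 0) (k := 2 * m)
      (by omega) (by omega) ha₀ hb₀]
    have hGw : gysinMap (complexOrientationRat hXY) (complexOrientationRat hY)
        (Literature.AlgebraicGeometry.Motives.AlgPoints.mapContinuous (L := ℂ) (snd X Y)) ha₀ hb₀
        (BettiUniverse.pull (fst X Y) (2 * n) (BettiUniverse.lineBasis hX (2 * n) h1X 0)) = 0 :=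
      hG0 _
    rw [hGw, LinearMap.map_zero₂]
  · -- every spelling of the degrees gives the same map
    obtain rfl : q = 2 * m := by omega
    exact key w

/-- **`snd_!(fst^* z ∪ (fst^* x ∪ snd^* y)) = (r · tr_X(z ∪ x)) • y`** for `z ∈ Hⁱ(X)`, `x ∈ Hʲ(X)` with
`i + j = 2 dim X`, `y ∈ Hˡ(Y)`, granted the base change to the point with constant `r` (hypothesis `hr`, supplied
by `exists_gysin_snd_pull_fst`): associativity of `∪`, multiplicativity of `fst^*`, the projection formula for
`snd`, and `((r · tr) • 1) ∪ y = (r · tr) • y`. -/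
theorem gysin_snd_cup_pull_fst_cup (hX : IsSmoothProjective n X) (hY : IsSmoothProjective m Y) {i j l : ℕ}
    (r : ℚ)
    (hr : ∀ {q₀ : ℕ} (ha₀ : i + j + q₀ = 2 * (n + m)) (hb₀ : 0 + q₀ = 2 * m) (w : bettiCohomology X (i + j)),
      gysinMap (complexOrientationRat (IsSmoothProjective.tensor_holds hX hY)) (complexOrientationRat hY)
          (Literature.AlgebraicGeometry.Motives.AlgPoints.mapContinuous (L := ℂ) (snd X Y)) ha₀ hb₀
          (BettiUniverse.pull (fst X Y) (i + j) w) =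
        (r * BettiUniverse.tr hX (i + j) w) • bettiOne Y)
    {q : ℕ} (ha : i + (j + l) + q = 2 * (n + m)) (hb : l + q = 2 * m) (z : bettiCohomology X i)
    (x : bettiCohomology X j) (y : bettiCohomology Y l) :
    gysinMap (complexOrientationRat (IsSmoothProjective.tensor_holds hX hY)) (complexOrientationRat hY)
        (Literature.AlgebraicGeometry.Motives.AlgPoints.mapContinuous (L := ℂ) (snd X Y)) ha hb
        (BettiUniverse.cup (X ⊗ Y) i (j + l) (BettiUniverse.pull (fst X Y) i z)
          (BettiUniverse.cup (X ⊗ Y) j l (BettiUniverse.pull (fst X Y) j x) (BettiUniverse.pull (snd X Y) l y))) =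
      (r * BettiUniverse.tr hX (i + j) (BettiUniverse.cup X i j z x)) • y := by
  -- reassociate and collect the pull-back along `fst`
  have hassoc : BettiUniverse.cup (X ⊗ Y) i (j + l) (BettiUniverse.pull (fst X Y) i z)
        (BettiUniverse.cup (X ⊗ Y) j l (BettiUniverse.pull (fst X Y) j x) (BettiUniverse.pull (snd X Y) l y)) =
      cupProduct (show i + j + l = i + (j + l) by omega)
        (BettiUniverse.pull (fst X Y) (i + j) (BettiUniverse.cup X i j z x)) (BettiUniverse.pull (snd X Y) l y) := by
    rw [BettiUniverse.pull_cup]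
    exact (cupProduct_assoc rfl rfl (show i + j + l = i + (j + l) by omega) rfl _ _ _).symm
  rw [hassoc]
  -- projection formula for `snd`, then the base change to the point
  have hproj := gysinMap_cupProduct_map
    (μY := complexOrientationRat (IsSmoothProjective.tensor_holds hX hY)) (μX := complexOrientationRat hY)
    (hasPoincareDuality_complexOrientationRat hY)
    (Literature.AlgebraicGeometry.Motives.AlgPoints.mapContinuous (L := ℂ) (snd X Y))
    (a := i + j) (p := l) (s := i + (j + l)) (q := q) (t := l) (k := l + q) (b := 0)
    (show i + j + l = i + (j + l) by omega) ha hb rfl (by omega) (by omega) (Nat.zero_add l)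
    (BettiUniverse.pull (fst X Y) (i + j) (BettiUniverse.cup X i j z x)) y
  rw [hr (q₀ := l + q) (by omega) (by omega), LinearMap.map_smul₂, one_cupProduct] at hproj
  exact hproj

/-! ### Fourier-type sums `Σ_c tr_X(z ∪ x_c) • y_c` -/

/-- **`snd_!(fst^* z ∪ Σ_c fst^* x_c ∪ snd^* y_c) = r • Σ_c tr_X(z ∪ x_c) • y_c`** (linearity and
`gysin_snd_cup_pull_fst_cup`), `r` the base-change constant of `hr`. -/
theorem gysin_snd_cup_pull_fst_sum (hX : IsSmoothProjective n X) (hY : IsSmoothProjective m Y) {i j l : ℕ}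
    (r : ℚ)
    (hr : ∀ {q₀ : ℕ} (ha₀ : i + j + q₀ = 2 * (n + m)) (hb₀ : 0 + q₀ = 2 * m) (w : bettiCohomology X (i + j)),
      gysinMap (complexOrientationRat (IsSmoothProjective.tensor_holds hX hY)) (complexOrientationRat hY)
          (Literature.AlgebraicGeometry.Motives.AlgPoints.mapContinuous (L := ℂ) (snd X Y)) ha₀ hb₀
          (BettiUniverse.pull (fst X Y) (i + j) w) =
        (r * BettiUniverse.tr hX (i + j) w) • bettiOne Y)
    {q : ℕ} (ha : i + (j + l) + q = 2 * (n + m)) (hb : l + q = 2 * m) {ι : Type*} (S : Finset ι)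
    (z : bettiCohomology X i) (x : ι → bettiCohomology X j) (y : ι → bettiCohomology Y l) :
    gysinMap (complexOrientationRat (IsSmoothProjective.tensor_holds hX hY)) (complexOrientationRat hY)
        (Literature.AlgebraicGeometry.Motives.AlgPoints.mapContinuous (L := ℂ) (snd X Y)) ha hb
        (BettiUniverse.cup (X ⊗ Y) i (j + l) (BettiUniverse.pull (fst X Y) i z)
          (∑ c ∈ S, BettiUniverse.cup (X ⊗ Y) j l (BettiUniverse.pull (fst X Y) j (x c))
            (BettiUniverse.pull (snd X Y) l (y c)))) =
      r • ∑ c ∈ S, BettiUniverse.tr hX (i + j) (BettiUniverse.cup X i j z (x c)) • y c := by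
  rw [map_sum, map_sum, Finset.smul_sum]
  refine Finset.sum_congr rfl fun c _ ↦ ?_
  rw [gysin_snd_cup_pull_fst_cup hX hY r hr ha hb z (x c) (y c), mul_smul]

/-- **Clause (i) of `Fact_algDuality` for Fourier-type operators (K-c, consumable form).**  Let `X`, `Y` be smooth
projective (dimensions `n`, `m`), `S` a finite set of indices, `x_c ∈ H^{2j}(X(ℂ); ℚ)`, `y_c ∈ H^{2s}(Y(ℂ); ℚ)`
with `p + j = n`, and suppose the class `u = Σ_{c ∈ S} fst^* x_c ∪ snd^* y_c ∈ H^{2j+2s}((X ⊗ Y)(ℂ); ℚ)` is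
rational algebraic (its complexification lies in `N^{j+s}`; e.g. `u = ± ℓⁱ`-expansions of a Poincaré class, K-b).
Then for every `z ∈ alg X p` the Fourier-type sum `Σ_{c ∈ S} tr_X(z ∪ x_c) • y_c` lies in `alg Y s`: it is
`r⁻¹ • snd_!(fst^* z ∪ u)` (`gysin_snd_cup_pull_fst_sum`, `exists_gysin_snd_pull_fst`), and `snd_!(fst^* z ∪ u)`
is algebraic (`gysin_cup_pull_mem_ratAlgebraicClasses'`).  (For `s > dim Y` the sum is `0`.) -/
theorem fourierSum_mem_ratAlgebraicClasses (hX : IsSmoothProjective n X) (hY : IsSmoothProjective m Y)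
    {p j s : ℕ} (hpj : p + j = n) {ι : Type*} (S : Finset ι) (x : ι → bettiCohomology X (2 * j))
    (y : ι → bettiCohomology Y (2 * s))
    (hu : ofRatClass (ComplexPoints (X ⊗ Y)) (2 * j + 2 * s)
        (∑ c ∈ S, BettiUniverse.cup (X ⊗ Y) (2 * j) (2 * s) (BettiUniverse.pull (fst X Y) (2 * j) (x c))
          (BettiUniverse.pull (snd X Y) (2 * s) (y c))) ∈
      supportedClasses (X ⊗ Y) (2 * j + 2 * s) (j + s))
    {z : bettiCohomology X (2 * p)} (hz : z ∈ ratAlgebraicClasses X p) :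
    ∑ c ∈ S, BettiUniverse.tr hX (2 * p + 2 * j) (BettiUniverse.cup X (2 * p) (2 * j) z (x c)) • y c ∈
      ratAlgebraicClasses Y s := by
  rcases lt_or_ge m s with hms | hsm
  · -- above the top degree of `Y` everything vanishes
    haveI : Subsingleton (bettiCohomology Y (2 * s)) :=
      Literature.AlgebraicGeometry.Motives.ComplexPoints.subsingleton_singularCohomology_of_lt hY ℚ (by omega)
    have h0 : (∑ c ∈ S, BettiUniverse.tr hX (2 * p + 2 * j) (BettiUniverse.cup X (2 * p) (2 * j) z (x c)) • y c) = 0 :=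
      Subsingleton.elim _ _
    rw [h0]
    exact Submodule.zero_mem _
  · obtain ⟨r, hr0, hr⟩ := exists_gysin_snd_pull_fst hX hY (k := 2 * p + 2 * j) (by omega)
    have hsum := gysin_snd_cup_pull_fst_sum hX hY (i := 2 * p) (j := 2 * j) (l := 2 * s) r hr
      (q := 2 * m - 2 * s) (by omega) (by omega) S z x y
    have halg := gysin_cup_pull_mem_ratAlgebraicClasses' (IsSmoothProjective.tensor_holds hX hY) hX hY
      (fst X Y) (snd X Y) (p := p) (a := 2 * j + 2 * s) (e := j + s) (s := s) (q := 2 * m - 2 * s) (by omega)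
      (by omega) (by omega) hu hz
    rw [hsum] at halg
    have h := (ratAlgebraicClasses Y s).smul_mem r⁻¹ halg
    rwa [smul_smul, inv_mul_cancel₀ hr0, one_smul] at h

/-- **Clause (i) of `Fact_algDuality`, operator form**: under the hypotheses of `fourierSum_mem_ratAlgebraicClasses`,
the Fourier-type operator `D = Σ_{c ∈ S} tr_X(– ∪ x_c) • y_c : H^{2p}(X(ℂ); ℚ) →ₗ H^{2s}(Y(ℂ); ℚ)` satisfies
`(alg X p).map D ≤ alg Y s` — the literal shape of clause (i) for the `D` of kernel K-a once written as such a sum. -/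
theorem ratAlgebraicClasses_map_fourierSum_le (hX : IsSmoothProjective n X) (hY : IsSmoothProjective m Y)
    {p j s : ℕ} (hpj : p + j = n) {ι : Type*} (S : Finset ι) (x : ι → bettiCohomology X (2 * j))
    (y : ι → bettiCohomology Y (2 * s))
    (hu : ofRatClass (ComplexPoints (X ⊗ Y)) (2 * j + 2 * s)
        (∑ c ∈ S, BettiUniverse.cup (X ⊗ Y) (2 * j) (2 * s) (BettiUniverse.pull (fst X Y) (2 * j) (x c))
          (BettiUniverse.pull (snd X Y) (2 * s) (y c))) ∈
      supportedClasses (X ⊗ Y) (2 * j + 2 * s) (j + s)) :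
    (ratAlgebraicClasses X p).map
        (∑ c ∈ S, (BettiUniverse.tr hX (2 * p + 2 * j) ∘ₗ (BettiUniverse.cup X (2 * p) (2 * j)).flip (x c)).smulRight
          (y c)) ≤
      ratAlgebraicClasses Y s := by
  rintro _ ⟨z, hz, rfl⟩
  have h := fourierSum_mem_ratAlgebraicClasses hX hY hpj S x y hu hz
  simp only [LinearMap.coe_sum, Finset.sum_apply, LinearMap.smulRight_apply, LinearMap.coe_comp,
    Function.comp_apply, LinearMap.flip_apply]
  exact h

end General

/-! ### The package shape on `PicardCM.Var` -/

section PicardCMVar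

/-- **K-c for the model universe `universeOf hHD hI hU h₃`** (binders `hU`, `h₃` only): for varieties `v`, `w` of
the Picard–CM universe, indices `c ∈ S`, classes `x_c ∈ H^{2j}(v)`, `y_c ∈ H^{2s}(w)` with `p + j = dim v` such that
`Σ_c fst^* x_c ∪ snd^* y_c` is a rational algebraic class on `v.prod w` (complexification in `N^{j+s}`), the
Fourier-type sum `Σ_c tr_v(z ∪ x_c) • y_c` of every `z ∈ alg v p` lies in `alg w s`.  (Row M22 uses
`v = w = prod4 K Φ`, `p = dim - 2`, `j = s = 2`.) -/
theorem var_fourierSum_mem_alg (hU : BallQuotientUniformisedDatum) (h₃ : CMAbelianVarietyRealised) (v w : Var)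
    {p j s : ℕ} (hpj : p + j = v.dim) {ι : Type*} (S : Finset ι) (x : ι → Var.Coh hU h₃ v (2 * j))
    (y : ι → Var.Coh hU h₃ w (2 * s))
    (hu : ofRatClass (ComplexPoints (Var.scheme hU h₃ (v.prod w))) (2 * j + 2 * s)
        (∑ c ∈ S, BettiUniverse.cup (Var.scheme hU h₃ (v.prod w)) (2 * j) (2 * s)
          (BettiUniverse.pull (Var.fst hU h₃ v w) (2 * j) (x c)) (BettiUniverse.pull (Var.snd hU h₃ v w) (2 * s) (y c))) ∈
      supportedClasses (Var.scheme hU h₃ (v.prod w)) (2 * j + 2 * s) (j + s))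
    {z : Var.Coh hU h₃ v (2 * p)} (hz : z ∈ Var.alg hU h₃ v p) :
    ∑ c ∈ S, BettiUniverse.tr (Var.isSmoothProjective hU h₃ v) (2 * p + 2 * j)
        (BettiUniverse.cup (Var.scheme hU h₃ v) (2 * p) (2 * j) z (x c)) • y c ∈ Var.alg hU h₃ w s :=
  fourierSum_mem_ratAlgebraicClasses (Var.isSmoothProjective hU h₃ v) (Var.isSmoothProjective hU h₃ w) hpj S x y
    hu hz

end PicardCMVar

end Summit.HodgeConjecture.CorCM.Model

end
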